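import Mathlib.Analysis.SpecialFunctions.Pow.Real
import HarnessLib

/-!
# K1L_D `stub_D1_V0thg` (stmt-AnomalousDissipation-27980), R3′ lane «SidebandTailCrushing» (tenure D28-16 (3) / D28-20) — file F5:
# PARAMETER BOOKKEEPING for the hypocoercivity constraints (pure real arithmetic; Mathlib only)

Helper file of route `SolenoidalFractalHomogenisation` (prover seat `ad-k1l-cellLawV-w1` g10; `--supports stmt-AnomalousDissipation-27980 --as helper`).
`hypocoercive_parameters`: given the structural constants `A, CJ ≥ 0`, `lo₁ > 0`, `0 < Gm`, `η₀ ≥ 0`, the odd ratio `ρ ≥ 0` (`= βo/(2lo')`) with its weight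
`Mo ≥ 0` (`= 8a²(1+|mᵢ|²)`), `U₁, U₂, U₃ > 0`, a hypocoercivity parameter `0 < b ≤ 1` and an odd balance `q > 0` subject to the FOUR scalar conditions
`2(4A+16CJ+1)²b³GM² ≤ Gm·lo₁` (size of `b`), `16bη₀ ≤ 1` (box end), `16ρq(1+Mo) ≤ 1` and `8ρ(1+Mo) ≤ (4A+16CJ+1)q` (odd viscosity; jointly feasible iff
`128ρ²(1+Mo)² ≤ 4A+16CJ+1`), the choice `β = b`, `α = (4A+16CJ+1)b²`, `s = b/q`, `s' = q/b`,
`lam = min(lo₁/(6α), lo₁/(6U₂), 1/(6U₃), 2bGm/(3U₁))` satisfies the twelve constraints P1–P8, P4b, P4c, P4d of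
`LadderCrush.hypocoercive_decay''` / `Sideband.ladder_crush` (with `η₁ = 0`, `η₂ = ρ(s⁻¹ + Mo s')`, `η₃ = ρ(Mo s + s'⁻¹)`), and `α, lam, s, s' > 0`.
The ν-scaling (`lo₁ ∝ ν`, `b ∝ ν^{1/3}`, `lam ∝ ν^{2/3}` when `U₁` dominates) is read off by the consumer.  No definitions, no sorry.
NOT a proof of `stub_D1_V0thg`, of K1L_D or of AD; rung F-D1.A0 infrastructure.
-/

set_option linter.dupNamespace false -- single-conjunct summit: `Summit.AnomalousDissipation.AnomalousDissipation.…` is the mandated namespace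

namespace Summit.AnomalousDissipation.AnomalousDissipation.Theorems.SolenoidalFractalHomogenisation.LagrangianStep.LadderCrush

noncomputable section

/-- `6·lam·X ≤ Y` when `lam ≤ Y/(6X)`, `X > 0`. -/
theorem six_mul_le_of_le_div {lam X Y : ℝ} (hX : 0 < X) (h : lam ≤ Y / (6 * X)) : 6 * lam * X ≤ Y := by
  have h6 : (0:ℝ) < 6 * X := by positivity
  have := (le_div_iff₀ h6).1 h
  linarith

set_option maxHeartbeats 400000 in -- pre-budgeted (ops-buildfix rule): twelve conjuncts
/-- **PARAMETER BOOKKEEPING for the twelve hypocoercivity constraints** (see the module docstring for the dictionary).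
[cite: BedrossianCotiZelati2017, §2 (hypocoercivity, enhanced dissipation)] -/
theorem hypocoercive_parameters {A CJ lo₁ Gm GM η₀ ρ Mo U₁ U₂ U₃ b q : ℝ} (hA : 0 ≤ A) (hCJ : 0 ≤ CJ) (hlo₁ : 0 < lo₁) (hGm : 0 < Gm)
    (hMo : 0 ≤ Mo) (hU₁ : 0 < U₁) (hU₂ : 0 < U₂) (hU₃ : 0 < U₃) (hb : 0 < b) (hq : 0 < q)
    (Q3 : 2 * (4 * A + 16 * CJ + 1) ^ 2 * b ^ 3 * GM ^ 2 ≤ Gm * lo₁) (Q4 : 16 * b * η₀ ≤ 1)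
    (Qc : 16 * ρ * q * (1 + Mo) ≤ 1) (Qd : 8 * ρ * (1 + Mo) ≤ (4 * A + 16 * CJ + 1) * q) :
    0 < (4 * A + 16 * CJ + 1) * b ^ 2 ∧
    0 < min (lo₁ / (6 * ((4 * A + 16 * CJ + 1) * b ^ 2))) (min (lo₁ / (6 * U₂)) (min (1 / (6 * U₃)) (2 * b * Gm / (3 * U₁)))) ∧
    0 < b / q ∧ 0 < q / b ∧
    4 * A * b ^ 2 ≤ (4 * A + 16 * CJ + 1) * b ^ 2 ∧
    16 * CJ * b ^ 2 ≤ (4 * A + 16 * CJ + 1) * b ^ 2 ∧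
    2 * ((4 * A + 16 * CJ + 1) * b ^ 2) ^ 2 * GM ^ 2 ≤ b * Gm * lo₁ ∧
    16 * b * η₀ ≤ 1 ∧
    8 * b * (0:ℝ) ≤ (4 * A + 16 * CJ + 1) * b ^ 2 ∧
    16 * b * (ρ * ((b / q)⁻¹ + Mo * (q / b))) ≤ 1 ∧
    8 * b * (ρ * (Mo * (b / q) + (q / b)⁻¹)) ≤ (4 * A + 16 * CJ + 1) * b ^ 2 ∧
    6 * min (lo₁ / (6 * ((4 * A + 16 * CJ + 1) * b ^ 2))) (min (lo₁ / (6 * U₂)) (min (1 / (6 * U₃)) (2 * b * Gm / (3 * U₁)))) *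
        ((4 * A + 16 * CJ + 1) * b ^ 2) ≤ lo₁ ∧
    6 * min (lo₁ / (6 * ((4 * A + 16 * CJ + 1) * b ^ 2))) (min (lo₁ / (6 * U₂)) (min (1 / (6 * U₃)) (2 * b * Gm / (3 * U₁)))) * U₂ ≤ lo₁ ∧
    6 * min (lo₁ / (6 * ((4 * A + 16 * CJ + 1) * b ^ 2))) (min (lo₁ / (6 * U₂)) (min (1 / (6 * U₃)) (2 * b * Gm / (3 * U₁)))) * U₃ ≤ 1 ∧
    3 * min (lo₁ / (6 * ((4 * A + 16 * CJ + 1) * b ^ 2))) (min (lo₁ / (6 * U₂)) (min (1 / (6 * U₃)) (2 * b * Gm / (3 * U₁)))) * U₁ ≤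
      2 * b * Gm := by
  set S := 4 * A + 16 * CJ + 1 with hS
  have hS0 : 0 < S := by rw [hS]; positivity
  have hα : 0 < S * b ^ 2 := by positivity
  set lam := min (lo₁ / (6 * (S * b ^ 2))) (min (lo₁ / (6 * U₂)) (min (1 / (6 * U₃)) (2 * b * Gm / (3 * U₁)))) with hlam
  have hl1 : lam ≤ lo₁ / (6 * (S * b ^ 2)) := min_le_left _ _
  have hl2 : lam ≤ lo₁ / (6 * U₂) := (min_le_right _ _).trans (min_le_left _ _)
  have hl3 : lam ≤ 1 / (6 * U₃) := ((min_le_right _ _).trans (min_le_right _ _)).trans (min_le_left _ _)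
  have hl4 : lam ≤ 2 * b * Gm / (3 * U₁) := ((min_le_right _ _).trans (min_le_right _ _)).trans (min_le_right _ _)
  have hlam0 : 0 < lam := by
    refine lt_min (by positivity) (lt_min (by positivity) (lt_min (by positivity) (by positivity)))
  have hbq : (b / q)⁻¹ = q / b := by rw [inv_div]
  have hqb : (q / b)⁻¹ = b / q := by rw [inv_div]
  refine ⟨hα, hlam0, by positivity, by positivity, ?_, ?_, ?_, Q4, ?_, ?_, ?_, six_mul_le_of_le_div hα hl1, six_mul_le_of_le_div hU₂ hl2,
    six_mul_le_of_le_div hU₃ hl3, ?_⟩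
  · have : 4 * A ≤ S := by rw [hS]; linarith
    exact mul_le_mul_of_nonneg_right this (sq_nonneg b)
  · have : 16 * CJ ≤ S := by rw [hS]; linarith
    exact mul_le_mul_of_nonneg_right this (sq_nonneg b)
  · -- P3 from Q3 · b
    have := mul_le_mul_of_nonneg_left Q3 hb.le
    have e1 : b * (2 * S ^ 2 * b ^ 3 * GM ^ 2) = 2 * (S * b ^ 2) ^ 2 * GM ^ 2 := by ring
    have e2 : b * (Gm * lo₁) = b * Gm * lo₁ := by ring
    rw [e1, e2] at this
    exact this
  · rw [mul_zero]; exact hα.le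
  · -- P4c from Qc
    rw [hbq]
    have e : 16 * b * (ρ * (q / b + Mo * (q / b))) = 16 * ρ * q * (1 + Mo) := by field_simp
    rw [e]; exact Qc
  · -- P4d from Qd
    rw [hqb]
    have e : 8 * b * (ρ * (Mo * (b / q) + b / q)) = (8 * ρ * (1 + Mo)) * b ^ 2 / q := by field_simp; ring
    rw [e, div_le_iff₀ hq]
    have := mul_le_mul_of_nonneg_right Qd (sq_nonneg b)
    have e2 : S * q * b ^ 2 = S * b ^ 2 * q := by ring
    rw [e2] at this
    exact this
  · -- P8
    have h3 : (0:ℝ) < 3 * U₁ := by positivity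
    have := (le_div_iff₀ h3).1 hl4
    linarith

end

end Summit.AnomalousDissipation.AnomalousDissipation.Theorems.SolenoidalFractalHomogenisation.LagrangianStep.LadderCrush
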